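import Summits.BirchSwinnertonDyer.BirchSwinnertonDyer.Theorems.PrintCf2RamifiedOffTYZLayerOneSilencePeriod
import Summits.BirchSwinnertonDyer.BirchSwinnertonDyer.Theorems.PrintCf2RamifiedOffTYZLevelTwoTwoStep
import HarnessLib

/-!
# Crux `PrintCf2.RamifiedOffTYZOfFacts` (stmt-BirchSwinnertonDyer-20509), line `offtyz-v7`, LEAD cycle 11 (cruxlead-20509 g10), part 4e:
# THE THREE-PRIME SECTOR `n = l₁l₂m`: under squares the genus period `Z(n)` moves EXACTLY as `𝓛(l₁l₂)·Z(m)` does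

THEOREMS ONLY (no `def`, no named fact, no `sorry`), `--supports stmt-BirchSwinnertonDyer-20509`.  Companion of `…LayerOneSilencePeriod` (p723163,
two primes: squares fix `Z(lm)`) on the type T sector of `…LevelTwoTwoStep` (p721626): `n = l₁l₂m`, `l₁ ≡ l₂ ≡ 1`, `m ≡ 5` or `7 (mod 8)`, `s(n) ≥ 2`.
From the exact recursion `Z(n) = P(n) + s₀𝓛(l₁l₂)·Z(m) + s₁𝓛(l₂)·P(l₁m) + s₂𝓛(l₁)·P(l₂m)`, the Layer-1 silence (`g²·P(n) = P(n)`, p722669) and the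
torsion/`K_d`-rationality bookkeeping (`2·(g²·P(d) − P(d)) = 0` for every proper divisor block with Thm 3.5 read in `ℍ′_n`, `𝓛(lᵢ)` even):
**`g²·Z(n) − Z(n) = s₀𝓛(l₁l₂)·(g²·Z(m) − Z(m))`** (`galPt_sq_genusPeriod_sub_eq_typeT`), and **squares fix `Z(n)` when `𝓛(l₁l₂)` is even**
(`galPt_sq_genusPeriod_eq_typeT_of_even`).  When `𝓛(l₁l₂)` is odd (`g(l₁l₂)` odd, Thm 1.1 at the rank-zero twist) the three-prime genus period is
moved by `g²` exactly when the PRIME's genus point `Z(m) = P(m)` is (an `s = 1` member: g7's mover exists) — in contrast with the two-prime sector.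
Hypotheses as in p723163/p721626; nothing is asserted; BSD is not proved by any of this.

References: [cite: TianYuanZhang2017, §3.1 (p0011 L53–L73), Thm. 3.5 (p0011 L94–L100), Lemma 3.18 (p0017 L152–L153), Thm. 3.6 (1), (3), proof of Lemma 3.21,
Thm. 1.1]; [cite: HeathBrown1994SelmerCongruentII, Appendix (Monsky), typescript p. 39 L10–L41]; tree: p723163, p722669, p721626, g4 `…GaloisMotion`.
-/

noncomputable section

open scoped Classical NumberField

open WeierstrassCurve WeierstrassCurve.Affine Finset Matrix Literature.NumberTheory.EllipticCurves
  Literature.NumberTheory.EllipticCurves.TianYuanZhang2017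
  Literature.NumberTheory.EllipticCurves.TianYuanZhang2017.W2
  Literature.NumberTheory.EllipticCurves.HeathBrown1994
  Literature.NumberTheory.QuadraticFields.RingClass
  Literature.NumberTheory.QuadraticFields
  Summit.BirchSwinnertonDyer.Rank1Residual.P2
  Summit.BirchSwinnertonDyer.PrintCf2.QForm
  Summit.BirchSwinnertonDyer.PrintCf2.MoverAssembly
  Summit.BirchSwinnertonDyer.PrintCf2.LevelTwoTwoPrimes
  Summit.BirchSwinnertonDyer.PrintCf2.LevelTwoTwoStep
  Summit.BirchSwinnertonDyer.PrintCf2.LayerOneSilenceOdd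
  Summit.BirchSwinnertonDyer.PrintCf2.LayerOneSilencePeriod

set_option autoImplicit false

namespace Summit.BirchSwinnertonDyer.PrintCf2.LayerOneSilencePeriodThree

variable {n : ℕ} (D : GenusPointData n)

/-- **`g²` fixes `2·P(d)` for a block `d` with Thm 3.5 read in `ℍ′_n` through a `K_d`-rational `α_d`** (odd `n`, Lemma 3.18): `2·P(d) ≡ (u·𝓛(d))·α_d`
modulo torsion, and both the torsion and `α_d` are fixed by every square. [cite: TianYuanZhang2017, Thm. 3.5 (p0011 L94–L100), Lemma 3.18] -/
theorem galPt_sq_two_smul_P_eq (hodd : Odd n) (h318 : D.lemma318) {d : ℕ} (hd : d ∈ n.divisors) {u M : ℤ} {α : APoint (GenusField d)}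
    (h35 : IsOfFinAddOrder ((2 : ℤ) • D.P d - (u * M) • Point.map (W' := curveA) (D.embK d hd) α)) (g : D.H ≃ₐ[ℚ] D.H) :
    D.galPt (g * g) ((2 : ℤ) • D.P d) = (2 : ℤ) • D.P d := by
  set t := (2 : ℤ) • D.P d - (u * M) • Point.map (W' := curveA) (D.embK d hd) α with ht
  have e : (2 : ℤ) • D.P d = t + (u * M) • Point.map (W' := curveA) (D.embK d hd) α := by rw [ht]; abel
  rw [e, map_add, map_zsmul, GaloisMotion.galPt_eq_self_of_isOfFinAddOrder D hodd h318 (g * g) (mul_self_apply_im D g) h35,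
    LayerOneSilencePeriod.galPt_map_embK_eq D (g * g) hd (mul_self_apply_sqrtNeg D g hd) α]

/-- **`g²` fixes `(2c)·P(d)`** (an EVEN multiple of a block point with Thm 3.5 read in `ℍ′_n`). [cite: TianYuanZhang2017, Thm. 3.5 (p0011 L94–L100), Lemma 3.18] -/
theorem galPt_sq_even_smul_P_eq (hodd : Odd n) (h318 : D.lemma318) {d : ℕ} (hd : d ∈ n.divisors) {L c u M : ℤ} (hL : L = 2 * c)
    {α : APoint (GenusField d)} (h35 : IsOfFinAddOrder ((2 : ℤ) • D.P d - (u * M) • Point.map (W' := curveA) (D.embK d hd) α))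
    (g : D.H ≃ₐ[ℚ] D.H) : D.galPt (g * g) (L • D.P d) = L • D.P d := by
  rw [hL, mul_comm, mul_smul, map_zsmul, galPt_sq_two_smul_P_eq D hodd h318 hd h35 g]

/-- **Type T: `g²·Z(n) − Z(n) = s₀𝓛(l₁l₂)·(g²·Z(m) − Z(m))`** for `n = l₁l₂m` (`lᵢ ≡ 1`, `m ≡ 5` or `7 (mod 8)`), `#Sel₂(E_n) = 2^{2+s}`, `s ≥ 2`, granted the
mover-criterion displays (for `![l₁, l₂, m]`-indexed primes `p`), Lemma 3.18, Thm 1.1, `𝓛(lᵢ) = 2cᵢ`, and Thm 3.5 at the two-prime sub-twists `l₁m`, `l₂m`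
read in `ℍ′_n` with `K`-rational `α`'s.  (`s₀ = ±1` is the recursion's sign at the block `m`.)
[cite: TianYuanZhang2017, §3.1 (p0011 L67–L73), Thm. 3.5, Lemma 3.18, Thm. 3.6 (1), (3), proof of Lemma 3.21, Thm. 1.1] [cite: HeathBrown1994SelmerCongruentII, Appendix (Monsky), typescript p. 39 L10–L41] -/
theorem galPt_sq_genusPeriod_sub_eq_typeT {k : ℕ} (p : Fin k → ℕ) (hp : ∀ i, (p i).Prime) (hpo : ∀ i, Odd (p i)) (hinj : Function.Injective p)
    {l₁ l₂ m : ℕ} (hl₁ : l₁.Prime) (hl₂ : l₂.Prime) (hm : m.Prime) (h18 : l₁ % 8 = 1) (h28 : l₂ % 8 = 1) (hm8 : m % 8 = 5 ∨ m % 8 = 7)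
    (hne : l₁ ≠ l₂) (hn : n = l₁ * l₂ * m) (hnp : n = ∏ i, p i)
    (hrec : D.recursion) (heps : D.epsSpec) (hLs : D.scriptLSpec) (h318 : D.lemma318)
    (z : ℕ → APoint D.H) (Φ : ℕ → Finset (D.H ≃ₐ[ℚ] D.H)) (ΓH ΓH' : ℕ → Subgroup (D.H ≃ₐ[ℚ] D.H))
    (σ : ℕ → (D.H ≃ₐ[ℚ] D.H)) (c : D.H ≃ₐ[ℚ] D.H) (ρ : (d : ℕ) → (D.galK d →* RingClassGroup (GenusField d) 2))
    (hc : D.ConjSpec c)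
    (hblock : ∀ d ∈ n.divisors, ((d % 8 = 5 ∨ d % 8 = 6) → D.CMBlockSpec d (z d) (Φ d) (ΓH d) (ΓH' d) (σ d) c) ∧
      (d % 8 = 7 → D.SevenBlockSpec d))
    (hring : ∀ d ∈ n.divisors, d % 8 = 5 → D.RingClassTwoBlockSpec d (ΓH d) (ΓH' d) (ρ d))
    (hFrob : ∀ d ∈ n.divisors, d % 8 = 5 → ∀ q : ℕ, q.Prime → q ∣ d → ∃ φ : D.H ≃ₐ[ℚ] D.H,
      φ (D.sqrtNeg d) = D.sqrtNeg d ∧ φ * φ ∈ ΓH' d ∧ φ D.im = (jacobiSym (-1) q) • D.im ∧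
        ∀ r : ℕ, r.Prime → r ∣ n → r ≠ q → φ (D.sqrtNeg r) = (jacobiSym (-(r : ℤ)) q) • D.sqrtNeg r)
    (h11 : thm11_parity_of_scriptL) {s : ℕ} (hs : 2 ≤ s) (hsel : Nat.card ((congruentNumberCurve n).selmerGroup 2) = 2 ^ (2 + s))
    {c₁ c₂ u₁ u₂ : ℤ} (hL₁ : D.scriptL l₁ = 2 * c₁) (hL₂ : D.scriptL l₂ = 2 * c₂)
    (h₁ : l₁ * m ∈ n.divisors) (h₂ : l₂ * m ∈ n.divisors) {α₁ : APoint (GenusField (l₁ * m))} {α₂ : APoint (GenusField (l₂ * m))}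
    (h35₁ : IsOfFinAddOrder ((2 : ℤ) • D.P (l₁ * m) - (u₁ * D.scriptL (l₁ * m)) • Point.map (W' := curveA) (D.embK (l₁ * m) h₁) α₁))
    (h35₂ : IsOfFinAddOrder ((2 : ℤ) • D.P (l₂ * m) - (u₂ * D.scriptL (l₂ * m)) • Point.map (W' := curveA) (D.embK (l₂ * m) h₂) α₂))
    (g : D.H ≃ₐ[ℚ] D.H) :
    ∃ s₀ : ℤ, (s₀ = 1 ∨ s₀ = -1) ∧
      D.galPt (g * g) (D.Z n) - D.Z n = s₀ • (D.scriptL (l₁ * l₂) • (D.galPt (g * g) (D.Z m) - D.Z m)) := by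
  have h57 : n % 8 = 5 ∨ n % 8 = 7 := by
    have : n % 8 = m % 8 := by
      rw [hn, mul_mod_eight_of_one (show (l₁ * l₂) % 8 = 1 by rw [Nat.mul_mod, h18, h28])]
    rw [this]; exact hm8
  have hodd : Odd n := Nat.odd_iff.mpr (by rcases h57 with h | h <;> omega)
  have hP : D.galPt (g * g) (D.P n) = D.P n :=
    galPt_sq_genusPoint_eq_of_card_selmer_odd p hp hpo hinj D hnp h57 hrec hLs z Φ ΓH ΓH' σ c ρ hc hblock hring hFrob h11 hs hsel g
  obtain ⟨-, s₀, s₁, s₂, hs₀, -, -, hPn⟩ := P_eq_of_typeT hl₁ hl₂ hm h18 h28 hm8 hne hn D hrec heps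
  refine ⟨s₀, hs₀, ?_⟩
  have hZ : D.Z n = D.P n + s₀ • (D.scriptL (l₁ * l₂) • D.Z m) + s₁ • (D.scriptL l₂ • D.P (l₁ * m))
      + s₂ • (D.scriptL l₁ • D.P (l₂ * m)) := by rw [hPn]; abel
  have hA : D.galPt (g * g) (s₁ • (D.scriptL l₂ • D.P (l₁ * m))) = s₁ • (D.scriptL l₂ • D.P (l₁ * m)) := by
    rw [map_zsmul, galPt_sq_even_smul_P_eq D hodd h318 h₁ hL₂ h35₁ g]
  have hB : D.galPt (g * g) (s₂ • (D.scriptL l₁ • D.P (l₂ * m))) = s₂ • (D.scriptL l₁ • D.P (l₂ * m)) := by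
    rw [map_zsmul, galPt_sq_even_smul_P_eq D hodd h318 h₂ hL₁ h35₂ g]
  have hC : D.galPt (g * g) (s₀ • (D.scriptL (l₁ * l₂) • D.Z m)) = s₀ • (D.scriptL (l₁ * l₂) • D.galPt (g * g) (D.Z m)) := by
    rw [map_zsmul, map_zsmul]
  rw [hZ, map_add, map_add, map_add, hP, hA, hB, hC]
  module

/-- **Type T, `𝓛(l₁l₂) = 2b` even: squares fix `Z(l₁l₂m)`** (same data, plus Thm 3.5 at the prime `m` with a `K_m`-rational `α_m`, making `𝓛(l₁l₂)·Z(m)`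
square-fixed as in the two-prime case). [cite: TianYuanZhang2017, §3.1 (p0011 L67–L73), Thm. 3.5, Lemma 3.18, Thm. 1.1] [cite: HeathBrown1994SelmerCongruentII, Appendix (Monsky), typescript p. 39 L10–L41] -/
theorem galPt_sq_genusPeriod_eq_typeT_of_even {k : ℕ} (p : Fin k → ℕ) (hp : ∀ i, (p i).Prime) (hpo : ∀ i, Odd (p i))
    (hinj : Function.Injective p) {l₁ l₂ m : ℕ} (hl₁ : l₁.Prime) (hl₂ : l₂.Prime) (hm : m.Prime) (h18 : l₁ % 8 = 1) (h28 : l₂ % 8 = 1)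
    (hm8 : m % 8 = 5 ∨ m % 8 = 7) (hne : l₁ ≠ l₂) (hn : n = l₁ * l₂ * m) (hnp : n = ∏ i, p i)
    (hrec : D.recursion) (heps : D.epsSpec) (hLs : D.scriptLSpec) (h318 : D.lemma318)
    (z : ℕ → APoint D.H) (Φ : ℕ → Finset (D.H ≃ₐ[ℚ] D.H)) (ΓH ΓH' : ℕ → Subgroup (D.H ≃ₐ[ℚ] D.H))
    (σ : ℕ → (D.H ≃ₐ[ℚ] D.H)) (c : D.H ≃ₐ[ℚ] D.H) (ρ : (d : ℕ) → (D.galK d →* RingClassGroup (GenusField d) 2))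
    (hc : D.ConjSpec c)
    (hblock : ∀ d ∈ n.divisors, ((d % 8 = 5 ∨ d % 8 = 6) → D.CMBlockSpec d (z d) (Φ d) (ΓH d) (ΓH' d) (σ d) c) ∧
      (d % 8 = 7 → D.SevenBlockSpec d))
    (hring : ∀ d ∈ n.divisors, d % 8 = 5 → D.RingClassTwoBlockSpec d (ΓH d) (ΓH' d) (ρ d))
    (hFrob : ∀ d ∈ n.divisors, d % 8 = 5 → ∀ q : ℕ, q.Prime → q ∣ d → ∃ φ : D.H ≃ₐ[ℚ] D.H,
      φ (D.sqrtNeg d) = D.sqrtNeg d ∧ φ * φ ∈ ΓH' d ∧ φ D.im = (jacobiSym (-1) q) • D.im ∧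
        ∀ r : ℕ, r.Prime → r ∣ n → r ≠ q → φ (D.sqrtNeg r) = (jacobiSym (-(r : ℤ)) q) • D.sqrtNeg r)
    (h11 : thm11_parity_of_scriptL) {s : ℕ} (hs : 2 ≤ s) (hsel : Nat.card ((congruentNumberCurve n).selmerGroup 2) = 2 ^ (2 + s))
    {c₁ c₂ b u₁ u₂ u : ℤ} (hL₁ : D.scriptL l₁ = 2 * c₁) (hL₂ : D.scriptL l₂ = 2 * c₂) (hL₁₂ : D.scriptL (l₁ * l₂) = 2 * b)
    (h₁ : l₁ * m ∈ n.divisors) (h₂ : l₂ * m ∈ n.divisors) (hmd : m ∈ n.divisors)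
    {α₁ : APoint (GenusField (l₁ * m))} {α₂ : APoint (GenusField (l₂ * m))} {αm : APoint (GenusField m)}
    (h35₁ : IsOfFinAddOrder ((2 : ℤ) • D.P (l₁ * m) - (u₁ * D.scriptL (l₁ * m)) • Point.map (W' := curveA) (D.embK (l₁ * m) h₁) α₁))
    (h35₂ : IsOfFinAddOrder ((2 : ℤ) • D.P (l₂ * m) - (u₂ * D.scriptL (l₂ * m)) • Point.map (W' := curveA) (D.embK (l₂ * m) h₂) α₂))
    (h35m : IsOfFinAddOrder ((2 : ℤ) • D.P m - (u * D.scriptL m) • Point.map (W' := curveA) (D.embK m hmd) αm))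
    (g : D.H ≃ₐ[ℚ] D.H) : D.galPt (g * g) (D.Z n) = D.Z n := by
  obtain ⟨s₀, -, h⟩ := galPt_sq_genusPeriod_sub_eq_typeT D p hp hpo hinj hl₁ hl₂ hm h18 h28 hm8 hne hn hnp hrec heps hLs h318 z Φ ΓH ΓH'
    σ c ρ hc hblock hring hFrob h11 hs hsel hL₁ hL₂ h₁ h₂ h35₁ h35₂ g
  have hodd : Odd n := by
    have : n % 8 = m % 8 := by
      rw [hn, mul_mod_eight_of_one (show (l₁ * l₂) % 8 = 1 by rw [Nat.mul_mod, h18, h28])]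
    exact Nat.odd_iff.mpr (by rcases hm8 with h' | h' <;> omega)
  obtain ⟨hPm, -⟩ := P_eq_of_typeT hl₁ hl₂ hm h18 h28 hm8 hne hn D hrec heps
  have hfix : D.galPt (g * g) (D.scriptL (l₁ * l₂) • D.Z m) = D.scriptL (l₁ * l₂) • D.Z m := by
    rw [← hPm]; exact galPt_sq_even_smul_P_eq D hodd h318 hmd hL₁₂ h35m g
  rw [map_zsmul] at hfix
  have h0 : D.scriptL (l₁ * l₂) • (D.galPt (g * g) (D.Z m) - D.Z m) = 0 := by rw [smul_sub, hfix, sub_self]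
  rw [h0, smul_zero, sub_eq_zero] at h
  exact h

end Summit.BirchSwinnertonDyer.PrintCf2.LayerOneSilencePeriodThree

end
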